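import Summits.NavierStokesRegularity.NavierStokesRegularity.Theses.SwirlStarvation
import Summits.NavierStokesRegularity.NavierStokesRegularity.Theorems.CertifiedBlowupConditions
import Summits.NavierStokesRegularity.NavierStokesRegularity.Theorems.AxisymmetricLiouvilleBoundedSwirl
import Literature.Analysis.FluidPDE.VorticityBlowupMaximal
import Literature.Analysis.FluidPDE.DecayingSelfSimilarEulerProfile
import Summits.NavierStokesRegularity.NavierStokesRegularity.Theorems.AxisymmetricSwirlRegularity

/-!
# Crux-strategist sketch — typed decomposition attempts for `SwirlStarvation.MarginalCreepBlowup`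

Seat `planner-cstrat-stmt-NavierStokesRegularity-13883-r1-0` (re-audit, RESTATED bin). Every candidate
split `X₁ ∧ … ∧ X_k → MarginalCreepBlowup` that is typeable over existing declarations is typed here,
its assembly proved, and — where the split violates criterion (c) "no piece is the crux / the summit on
its own" — the violating implication is proved too (kernel-checked reasons for the census).
-/

namespace Summit.NavierStokesRegularity.NavierStokesRegularity.Cruxes.MarginalCreepBlowup.Strategist

open Set Filter
open scoped ContDiff
open Literature.Analysis.FluidPDE
open Summit.NavierStokesRegularity.NavierStokesRegularity.Theses.SwirlStarvation

local notation "ℝ³" => EuclideanSpace ℝ (Fin 3)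

/-- The crux, by name. -/
abbrev MCB : Prop := MarginalCreepBlowup

/-! ## D1 — rate-ceiling split: `AxisymBlowupAllTimes ∧ MarginalCeiling → MCB` -/

/-- Piece 1 of D1: an axisymmetric (at all times) Leray–Hopf classical blow-up from a rapidly decaying
datum exists (the shared `AxisymBlowup` stmt-0727 with axisymmetry propagated). -/
def AxisymBlowupAllTimes : Prop :=
  ∃ ν : ℝ, 0 < ν ∧ ∃ T : ℝ, 0 < T ∧ ∃ (u : ℝ → ℝ³ → ℝ³) (p : ℝ → ℝ³ → ℝ),
    IsMaximalSmoothSolution ν 0 u p T ∧ IsLerayHopfOn T ν 0 (u 0) u ∧ HasRapidSpatialDecay (u 0) ∧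
      ∀ t ∈ Ico 0 T, IsAxisymmetric (u t)

/-- Piece 2 of D1: MARGINAL CEILING — every axisymmetric Leray–Hopf classical blow-up creeps at most
marginally (a universal, regularity-flavoured statement: the one-loop / Γ-front template is the only
way an axisymmetric solution can blow up). -/
def MarginalCeiling : Prop :=
  ∀ (ν T : ℝ), 0 < ν → 0 < T → ∀ (u : ℝ → ℝ³ → ℝ³) (p : ℝ → ℝ³ → ℝ),
    IsMaximalSmoothSolution ν 0 u p T → IsLerayHopfOn T ν 0 (u 0) u → HasRapidSpatialDecay (u 0) →
      (∀ t ∈ Ico 0 T, IsAxisymmetric (u t)) →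
        ∃ C : ℝ, ∃ t₁ ∈ Ico 0 T, ∀ t ∈ Ico t₁ T, ∀ x : ℝ³,
          ‖u t x‖ ^ 2 * (T - t) ≤ C * ν * (1 + Real.log (T / (T - t)))

/-- Assembly of D1 (modus ponens + repackaging). -/
theorem mcb_of_D1 (h₁ : AxisymBlowupAllTimes) (h₂ : MarginalCeiling) : MCB := by
  obtain ⟨ν, hν, T, hT, u, p, hmax, hLH, hdec, hax⟩ := h₁
  exact ⟨ν, hν, T, hT, u, p, hmax, hLH, hdec, hax, h₂ ν T hν hT u p hmax hLH hdec hax⟩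

/-- WHY D1 VIOLATES (c): piece 1 alone already refutes the summit — the route's own eleven-line
`closes` argument runs from `AxisymBlowupAllTimes` verbatim (Clay uniqueness 0153 is a tree theorem). -/
theorem D1_piece1_refutes_summit (h₁ : AxisymBlowupAllTimes) : ¬ _root_.NavierStokesRegularity := by
  have hU : BlowupClayUniqueness :=
    _root_.Summit.NavierStokesRegularity.NavierStokesRegularity.Theorems.adiabaticEddy_clayUniqueness_proof
  intro hReg
  obtain ⟨ν, hν, T, hT, u, p, ⟨hcl, hmax⟩, hLH, hdec, -⟩ := h₁
  have h0 : (0 : ℝ) ∈ Set.Ico 0 T := ⟨le_rfl, hT⟩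
  obtain ⟨u', p', hu', hp', hns, hbe⟩ :=
    hReg ν hν (u 0) (hcl.contDiff_velocity h0) (hcl.divFree 0 h0) hdec
  have heq : ∀ t ∈ Set.Ico 0 T, u' t = u t :=
    hU ν hν (u 0) hdec u' u p' p T hT hu' hp' hns hbe hcl hLH rfl
  have hcl' : IsClassicalNSSolutionOn (Set.Ici 0) ν 0 u' p' :=
    ⟨hu', hp', fun t ht x => hns.momentum t ht x, fun t ht => hns.divFree t ht⟩
  refine hmax ⟨T + 1, by linarith, u', p', ?_, heq⟩
  exact hcl'.mono (fun t ht => ht.1) (uniqueDiffOn_Ico 0 (T + 1))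

/-- And MCB gives piece 1 by forgetting the rate (so piece 1 is sandwiched ¬S ⇐ piece 1 ⇐ MCB). -/
theorem D1_piece1_of_mcb (h : MCB) : AxisymBlowupAllTimes := by
  obtain ⟨ν, hν, T, hT, u, p, hmax, hLH, hdec, hax, -⟩ := h
  exact ⟨ν, hν, T, hT, u, p, hmax, hLH, hdec, hax⟩


/-! ## D2 — abstract certificate split (Chen–Hou shape over the landed `StabilityFrame` API):
`CertificateExists ∧ CertificateBlowup → MCB` -/

/-- Piece 1 of D2: some finite rational datum `d` with an analytic frame `F` satisfies the landed
inequality package `BlowupProfileConditions d F` (residual/coercivity/closure/exponents). -/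
def CertificateExists : Prop :=
  ∃ d : Literature.NS.BlowupProfileData, ∃ F : Literature.NS.StabilityFrame d,
    Literature.NS.BlowupProfileConditions d F

/-- Piece 2 of D2: every certified datum yields a marginally creeping axisymmetric blow-up (the shape
of CertifiedBlowup's informal item 0269 with the rate class changed). -/
def CertificateBlowup : Prop :=
  ∀ d : Literature.NS.BlowupProfileData, ∀ F : Literature.NS.StabilityFrame d,
    Literature.NS.BlowupProfileConditions d F → MCB

/-- Assembly of D2 (modus ponens). -/
theorem mcb_of_D2 (h₁ : CertificateExists) (h₂ : CertificateBlowup) : MCB := by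
  obtain ⟨d, F, hc⟩ := h₁
  exact h₂ d F hc

/-- A toy datum at the critical Navier–Stokes exponents `(c_l, c_ω) = (1/2, -1)`, no profile
coefficients, no unstable directions, `ε = 0`, `κ = 1`, no nonlinear constants. -/
def toyDatum : Literature.NS.BlowupProfileData where
  symmetry := .axisymSwirlOdd
  cl := 1 / 2
  cw := -1
  numComponents := 0
  degR := 0
  degZ := 0
  coeff := fun i => i.elim0
  domainRadius := 1
  domainHeight := 1
  unstableRank := 0
  unstableBasis := fun i => i.elim0
  residualBound := 0
  coercivity := 1
  nonlinearConsts := []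

/-- A toy frame over the one-dimensional Euclidean space: zero residual, the coercive form
`v ↦ -‖v‖²`, no nonlinear terms. It has NO relation to Navier–Stokes — which is the point. -/
noncomputable def toyFrame : Literature.NS.StabilityFrame toyDatum where
  X := EuclideanSpace ℝ (Fin 1)
  reconstruct := fun _ => 0
  residual := 0
  linForm := fun v => -‖v‖ ^ 2
  nonlinForms := []

/-- The toy pair satisfies the full landed package (i)–(iv). -/
theorem toy_conditions : Literature.NS.BlowupProfileConditions toyDatum toyFrame where
  residual_le := by
    change ‖(0 : EuclideanSpace ℝ (Fin 1))‖ ≤ ((0 : ℚ) : ℝ)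
    simp
  coercive := fun v _ => by
    change -‖v‖ ^ 2 ≤ -((1 : ℚ) : ℝ) * ‖v‖ ^ 2
    simp
  nonlin_le := by
    change List.Forall₂ _ [] []
    exact List.Forall₂.nil
  closure := ⟨1, by
    norm_num [Literature.NS.BlowupProfileData.ClosureAt, Literature.NS.BlowupProfileData.nonlinConst,
      toyDatum]⟩
  exponents := by
    norm_num [Literature.NS.BlowupProfileData.ExponentsAdmissible, toyDatum]

/-- Piece 1 of D2 is PROVABLE NOW by a witness with no fluid content. -/
theorem certificateExists_toy : CertificateExists :=
  ⟨toyDatum, toyFrame, toy_conditions⟩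

/-- WHY D2 VIOLATES (c): piece 2 is EQUIVALENT to the crux (kernel-checked). The abstract frame
carries no Navier–Stokes semantics; the canonical frame `nsFrame d` of the CertifiedBlowup design is
not constructed, and for the marginal (log-drifting) class no constant-exponent frame can be. -/
theorem D2_piece2_iff_mcb : CertificateBlowup ↔ MCB :=
  ⟨fun h => mcb_of_D2 certificateExists_toy h, fun h _ _ _ => h⟩

/-! ## D3 — explicit-datum / a-priori-estimates split (the shape of the tree's
`ChenHou2022_aprioriBlowupEstimates ∧ Ferrari1993_periodicCylinderEulerBKM → blow-up`):
`AprioriMarginalCreep ∧ LocalTheoryDichotomy → MCB`, with a NON-trivial assembly -/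

/-- Admissible Navier–Stokes data for the axisymmetric scenario: smooth, divergence free, rapidly
decaying (Fefferman (4)), axisymmetric. -/
def IsAdmissibleDatum (u₀ : ℝ³ → ℝ³) : Prop :=
  ContDiff ℝ ∞ u₀ ∧ VectorCalculus.IsDivFree u₀ ∧ HasRapidSpatialDecay u₀ ∧ IsAxisymmetric u₀

/-- Piece 1 of D3 (OPEN — the computer-assisted target in a-priori form): for some viscosity, some
admissible datum `u₀` and some time `T* > 0`, EVERY axisymmetric Leray–Hopf classical solution from
`u₀` on a slab `[0, T')` (i) stays bounded before `T*`, (ii) has vorticity blowing up inside the unit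
ball at `T*` if it lives that long, and (iii) creeps at most marginally relative to `T*`. -/
def AprioriMarginalCreep : Prop :=
  ∃ ν : ℝ, 0 < ν ∧ ∃ u₀ : ℝ³ → ℝ³, IsAdmissibleDatum u₀ ∧ ∃ Ts : ℝ, 0 < Ts ∧
    ∀ (T' : ℝ) (u : ℝ → ℝ³ → ℝ³) (p : ℝ → ℝ³ → ℝ),
      IsClassicalNSSolutionOn (Ico 0 T') ν 0 u p → u 0 = u₀ → IsLerayHopfOn T' ν 0 u₀ u →
        (∀ t ∈ Ico 0 T', IsAxisymmetric (u t)) →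
          (∀ T'' : ℝ, T'' < Ts → ∃ M : ℝ, ∀ t ∈ Ico 0 (min T' T''), ∀ x : ℝ³, ‖u t x‖ ≤ M) ∧
          (Ts ≤ T' → VorticityBlowsUpOnAt (Metric.ball (0 : ℝ³) 1) u Ts) ∧
          (∃ C : ℝ, ∃ t₁ ∈ Ico 0 Ts, ∀ t ∈ Ico t₁ (min T' Ts), ∀ x : ℝ³,
            ‖u t x‖ ^ 2 * (Ts - t) ≤ C * ν * (1 + Real.log (Ts / (Ts - t))))

/-- Piece 2 of D3 (KNOWN — Leray 1934 local theory with Leray/BKM continuation and KNSS §1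
propagation of axisymmetry, packaged as a dichotomy exactly like the tree's
`Ferrari1993_periodicCylinderEulerBKM`): from an admissible datum there is an axisymmetric
Leray–Hopf classical solution which is either global or maximal with finite lifespan `Tm` and
unbounded velocity before `Tm`. -/
def LocalTheoryDichotomy : Prop :=
  ∀ ν : ℝ, 0 < ν → ∀ u₀ : ℝ³ → ℝ³, IsAdmissibleDatum u₀ →
    ∃ (u : ℝ → ℝ³ → ℝ³) (p : ℝ → ℝ³ → ℝ), u 0 = u₀ ∧
      ((IsClassicalNSSolutionOn (Ici 0) ν 0 u p ∧ (∀ T : ℝ, 0 < T → IsLerayHopfOn T ν 0 u₀ u) ∧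
          ∀ t : ℝ, 0 ≤ t → IsAxisymmetric (u t)) ∨
        (∃ Tm : ℝ, 0 < Tm ∧ IsMaximalSmoothSolution ν 0 u p Tm ∧ IsLerayHopfOn Tm ν 0 u₀ u ∧
          (∀ t ∈ Ico 0 Tm, IsAxisymmetric (u t)) ∧
          ∀ M : ℝ, ∃ t ∈ Ico 0 Tm, ∃ x : ℝ³, M < ‖u t x‖))

/-- Assembly of D3 — genuinely more than a seam: the global branch and the branches `Tm < T*`,
`T* < Tm` are each refuted (vorticity blow-up inside a bounded region forbids classical continuation,
tree lemma `VorticityBlowsUpOnAt.not_hasSmoothExtensionPast`; the a-priori bound forbids an earlier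
blow-up), leaving `Tm = T*`, where the pieces assemble to the crux. -/
theorem mcb_of_D3 (hA : AprioriMarginalCreep) (hL : LocalTheoryDichotomy) : MCB := by
  obtain ⟨ν, hν, u₀, hadm, Ts, hTs, hall⟩ := hA
  obtain ⟨u, p, h0, hcase⟩ := hL ν hν u₀ hadm
  rcases hcase with ⟨hcl, hLH, hax⟩ | ⟨Tm, hTm, hmax, hLH, hax, hunb⟩
  · -- global branch: restrict to `[0, T* + 1)` and contradict the blow-up at `T*`
    exfalso
    have hcl' : IsClassicalNSSolutionOn (Ico 0 (Ts + 1)) ν 0 u p :=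
      hcl.mono (fun t ht => ht.1) (uniqueDiffOn_Ico 0 (Ts + 1))
    have hax' : ∀ t ∈ Ico 0 (Ts + 1), IsAxisymmetric (u t) := fun t ht => hax t ht.1
    obtain ⟨-, hblow, -⟩ := hall (Ts + 1) u p hcl' h0 (hLH (Ts + 1) (by linarith)) hax'
    have hb : VorticityBlowsUpOnAt (Metric.ball (0 : ℝ³) 1) u Ts := hblow (by linarith)
    exact hb.not_hasSmoothExtensionPast Metric.isBounded_ball hTs ν 0
      (hcl'.hasSmoothExtensionPast (by linarith))
  · obtain ⟨hbound, hblow, hrate⟩ := hall Tm u p hmax.1 h0 hLH hax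
    rcases lt_trichotomy Tm Ts with hlt | heq | hgt
    · -- a blow-up before `T*` contradicts the a-priori velocity bound
      exfalso
      obtain ⟨M, hM⟩ := hbound ((Tm + Ts) / 2) (by linarith)
      obtain ⟨t, ht, x, hx⟩ := hunb M
      have ht' : t ∈ Ico 0 (min Tm ((Tm + Ts) / 2)) := ⟨ht.1, lt_min ht.2 (by linarith [ht.2])⟩
      exact absurd (hM t ht' x) (not_le.2 hx)
    · -- `Tm = T*`: the pieces assemble
      subst heq
      refine ⟨ν, hν, Tm, hTm, u, p, hmax, ?_, ?_, hax, ?_⟩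
      · rw [h0]; exact hLH
      · rw [h0]; exact hadm.2.2.1
      · obtain ⟨C, t₁, ht₁, hC⟩ := hrate
        exact ⟨C, t₁, ht₁, fun t ht x => hC t ⟨ht.1, lt_min ht.2 ht.2⟩ x⟩
    · -- a lifespan beyond `T*` contradicts the blow-up at `T*`
      exfalso
      exact (hblow hgt.le).not_hasSmoothExtensionPast Metric.isBounded_ball hTs ν 0
        (hmax.1.hasSmoothExtensionPast hgt)

/-! ## D4 — Euler-profile ∧ viscous-creep transfer (Merle–Raphaël–Rodnianski–Szeftel shape) -/

/-- Piece 1 of D4 (OPEN, a free-space Euler problem): a nontrivial axisymmetric decaying self-similar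
Euler profile exists at some collapse exponent `γ` (Chen–Hou's theorem has a boundary; Elgindi's
profile is `C^{1,α}`). -/
def AxisymEulerProfileExists : Prop :=
  ∃ γ : ℝ, 0 < γ ∧ ∃ (U : ℝ³ → ℝ³) (P : ℝ³ → ℝ),
    IsDecayingSelfSimilarEulerProfile γ (0 : ℝ³) U P ∧ IsAxisymmetric U ∧ U ≠ 0

/-- Piece 2 of D4: the bare transfer bridge (no mechanism in print at constant `ν`, `n = 3`). -/
def ViscousCreepTransfer : Prop :=
  AxisymEulerProfileExists → MCB

/-- Assembly of D4 (modus ponens). -/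
theorem mcb_of_D4 (h₁ : AxisymEulerProfileExists) (h₂ : ViscousCreepTransfer) : MCB :=
  h₂ h₁

/-! ## D5 — ancient-solution split (Albritton–Barker shape): `¬(AX-L) ∧ bridge → MCB` -/

/-- Piece 1 of D5 (OPEN, a Liouville problem): the canonical conjecture leaf AX-L fails — a
non-constant bounded ancient axisymmetric mild solution with bounded swirl exists. -/
def AncientAxisymNonLiouville : Prop :=
  ¬ _root_.Summit.NavierStokesRegularity.NavierStokesRegularity.AxisymmetricLiouvilleBoundedSwirl

/-- Piece 2 of D5: the bare blow-down bridge. -/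
def AncientToCreep : Prop :=
  AncientAxisymNonLiouville → MCB

/-- Assembly of D5 (modus ponens). -/
theorem mcb_of_D5 (h₁ : AncientAxisymNonLiouville) (h₂ : AncientToCreep) : MCB :=
  h₂ h₁

/-! ## D8 — time-slab split: local vorticity blow-up + rate, maximality supplied by the tree -/

/-- The would-be open piece of D8: the crux with `IsMaximalSmoothSolution` replaced by vorticity
blow-up inside some ball at `T`. -/
def LocalisedCreepBlowup : Prop :=
  ∃ ν : ℝ, 0 < ν ∧ ∃ T : ℝ, 0 < T ∧ ∃ (u : ℝ → ℝ³ → ℝ³) (p : ℝ → ℝ³ → ℝ),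
    IsClassicalNSSolutionOn (Ico 0 T) ν 0 u p ∧ IsLerayHopfOn T ν 0 (u 0) u ∧
      HasRapidSpatialDecay (u 0) ∧ (∀ t ∈ Ico 0 T, IsAxisymmetric (u t)) ∧
      (∃ R : ℝ, VorticityBlowsUpOnAt (Metric.ball (0 : ℝ³) R) u T) ∧
      ∃ C : ℝ, ∃ t₁ ∈ Ico 0 T, ∀ t ∈ Ico t₁ T, ∀ x : ℝ³,
        ‖u t x‖ ^ 2 * (T - t) ≤ C * ν * (1 + Real.log (T / (T - t)))

/-- WHY D8 IS NO SPLIT: its open piece already gives the crux through the tree's continuation lemma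
(three lines), so the "second piece" is a landed theorem and `k = 1`. -/
theorem mcb_of_D8 (h : LocalisedCreepBlowup) : MCB := by
  obtain ⟨ν, hν, T, hT, u, p, hcl, hLH, hdec, hax, ⟨R, hbu⟩, hrate⟩ := h
  exact ⟨ν, hν, T, hT, u, p, hbu.isMaximalSmoothSolution Metric.isBounded_ball hT hcl, hLH, hdec,
    hax, hrate⟩

/-! ## D6 — the route's own supports: `StarvationFailureBlowup : ¬StarvationFloor → MCB` is a
`k = 1` "split" whose piece is STRONGER than the crux; `CreepDichotomy : NoMarginalCreep ↔ ¬MCB`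
is the negation. Recorded by name only. -/

example : StarvationFailureBlowup = (¬ StarvationFloor → MarginalCreepBlowup) := rfl
example : CreepDichotomy = (NoMarginalCreep ↔ ¬ MarginalCreepBlowup) := rfl


/-! ## D12 — regularity-negation split: `¬AxisymmetricSwirlRegularity ∧ (…) → MCB`; piece 1 is the
summit's negation restricted to axisymmetric data -/

/-- WHY D12 VIOLATES (c): the negation of the canonical conjecture leaf AX (global regularity for
axisymmetric data) refutes the summit outright — Clay (A) specialised to axisymmetric data, with the
field-for-field identification of the Fefferman predicates with `IsClassicalNSSolutionOn (Ici 0)`. -/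
theorem D12_piece1_refutes_summit
    (h : ¬ _root_.Summit.NavierStokesRegularity.NavierStokesRegularity.AxisymmetricSwirlRegularity) :
    ¬ _root_.NavierStokesRegularity := by
  intro hS
  apply h
  intro ν hν u₀ hsm hdiv hdec _hax
  obtain ⟨u, p, hu, hp, hns, hbe⟩ := hS ν hν u₀ hsm hdiv hdec
  exact ⟨u, p, ⟨hu, hp, fun t ht x => hns.momentum t ht x, fun t ht => hns.divFree t ht⟩,
    hns.initial, hbe⟩

end Summit.NavierStokesRegularity.NavierStokesRegularity.Cruxes.MarginalCreepBlowup.Strategist
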